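import Literature.AlgebraicGeometry.ShimuraVarieties.UnitaryBallQuotientDatum
import Literature.AlgebraicGeometry.HodgeTheory.AbsoluteHodgeClasses
import HarnessLib
import HarnessLib.Audit

/-!
# The conjecture `BallQuotientHodgeAbsolute` (open; an obligation node of summit `HodgeConjecture`)

`BallQuotientHodgeAbsolute` is the instance, for even-dimensional compact arithmetic ball quotients
and the middle degree, of the conjecture "Hodge classes are absolute Hodge" (Charles–Schnell,
*Notes on absolute Hodge classes*, Conjecture 11.2.17; Deligne 1982): for every `m`, every
`X / ℂ` carrying a `UnitaryBallQuotientDatum (2(m+1)) X` (so `X(ℂ) ≅ Γ\𝔹^{2(m+1)}` is a smooth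
projective compact ball quotient) and every RATIONAL class `c ∈ H^{2(m+1)}(X(ℂ); ℂ)` of Hodge
type `(m+1, m+1)`, the class `c` is absolute Hodge (`IsAbsoluteHodgeClass`). It is OPEN and is
recorded here as an `@[conjecture]` statement — never asserted; users take it as an explicit
hypothesis `(h : BallQuotientHodgeAbsolute)`.

History: this statement was the route item
`Summit.HodgeConjecture.HodgeConjecture.Theses.EndoscopicMiddleDegree.BallQuotientHodgeAbsolute`
(stmt-HodgeConjecture-14348, a crux through route rev 3) until rev 4 of that route dropped it
(2026-08-16T03:06Z; not load-bearing for the revised deciding path). The negative-lane files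
`Theorems/BallQuotientHodgeAbsolute/Negative/*.lean` (read-back, "a kill is `¬HC`", equivalence
with middle-degree HC on the family, chart-conjugation uniqueness) name it unqualified inside
`namespace Summit.HodgeConjecture.HodgeConjecture.Theorems.…`, so it is re-homed here, in their
enclosing namespace, with the statement VERBATIM.

## References

* F. Charles, C. Schnell, *Notes on absolute Hodge classes*, in: Hodge Theory (Princeton, 2014),
  §11.2.2 (Def. 11.2.3), §11.2.5 (Conj. 11.2.17). [CharlesSchnell2014Notes]
* P. Deligne, *Hodge cycles on abelian varieties*, LNM 900 (1982), §2.
-/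

-- `Summit.<Summit>.<Problem>` is the mandated summit-side namespace (CONVENTIONS §2); for the
-- single-conjunct summit `HodgeConjecture` the two coincide, so the duplicate is deliberate.
set_option linter.dupNamespace false

namespace Summit.HodgeConjecture.HodgeConjecture.Theorems

/-- OPEN — **Hodge classes in the middle degree of compact ball quotients are absolute Hodge.**
For every `m : ℕ` and every `X / ℂ` with a `UnitaryBallQuotientDatum (2 * (m + 1)) X`, every
rational class `c ∈ H^{2(m+1)}(X(ℂ); ℂ)` of Hodge type `(m+1, m+1)` is an absolute Hodge class.
The special case (this family, this degree) of Charles–Schnell's Conjecture 11.2.17 "Hodge classes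
are absolute Hodge"; open. Never asserted; an explicit hypothesis wherever used. Verbatim the former
route item `Summit.HodgeConjecture.HodgeConjecture.Theses.EndoscopicMiddleDegree.BallQuotientHodgeAbsolute`
(stmt-HodgeConjecture-14348).
[cite: CharlesSchnell2014Notes, §11.2.5 Conj. 11.2.17 (instance: middle degree of compact ball quotients; open)] -/
@[conjecture] def BallQuotientHodgeAbsolute : Prop :=
  ∀ (m : ℕ) (X : Literature.AlgebraicGeometry.Motives.SchemeOver ℂ),
    Nonempty (Literature.AlgebraicGeometry.ShimuraVarieties.UnitaryBallQuotientDatum (2 * (m + 1)) X) →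
      ∀ c : Literature.AlgebraicGeometry.HodgeTheory.complexBetti X (2 * (m + 1)),
        Literature.AlgebraicGeometry.HodgeTheory.IsRationalClass c →
          Literature.AlgebraicGeometry.HodgeTheory.IsOfHodgeType (2 * (m + 1)) X (2 * (m + 1)) (m + 1)
              (m + 1) c →
            Literature.AlgebraicGeometry.HodgeTheory.IsAbsoluteHodgeClass (2 * (m + 1)) X (m + 1) c

end Summit.HodgeConjecture.HodgeConjecture.Theorems
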